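import Literature.MathematicalPhysics.QuantumManyBody.PeriodicBoseGasScatteringSolution
import Literature.MathematicalPhysics.QuantumManyBody.PeriodicBoseGasEq229Bdd
import Literature.MathematicalPhysics.QuantumManyBody.PeriodicBoseGasLemma24Bdd
import Literature.MathematicalPhysics.QuantumManyBody.PeriodicBoseGasEq243Bdd
import Literature.MathematicalPhysics.QuantumManyBody.PeriodicBoseGasThm21Bdd
import Literature.MathematicalPhysics.QuantumManyBody.PeriodicBoseGasEq317Bdd
import HarnessLib

/-!
# Fournais 2020, (1.12): the lower bound on `H̃` (proof of `Fournais2020_lowerBound_Htilde`)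

Topic `Literature/MathematicalPhysics/QuantumManyBody`, sibling of `PeriodicBoseGasProofs.lean`
(provefact `Literature.MathematicalPhysics.QuantumManyBody.BoseGas.Fournais2020_lowerBound_Htilde`).
That file vendors the lower bound [Fournais2020, (1.12) with the sign of (3.3)],
`⟨Ψ, H̃Ψ⟩ ≥ 4πaρN - C aρ(ρa³)^{1/2} N` on the boxes `L = C_L(ρa³)^{-δ}(ρa)^{-1/2}` (1.7),
`H̃ = ∑ⱼ(-Δⱼ - 2π²L⁻²Q_{Ω,j}) + ∑_{j<k} v^per(xⱼ - x_k)` (1.11), as the named fact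
`Fournais2020_lowerBound_Htilde`, and proves it from [Fournais2020, Thm. 3.1]
(`Fournais2020_lowerBound_Htilde_of_thm31`: (3.3) at `ρ_μ = ρ`). This file closes the fact by
joining the proof files of the topic, which by now contain every layer of the printed proof:

* Thm. 3.1 ⇐ scattering solution + (3.17): `Fournais2020_thm31_of_scattering_eq317`
  (Lemmas 3.2–3.3, `PeriodicBoseGasKineticMultiplierProofs.lean`), `LSSY2005_scatteringSolution_holds`;
* (3.17) ⇐ Thm. 2.1 on bounded states: `Fournais2020_eq317_of_thm21_bdd` (`PeriodicBoseGasEq317Bdd.lean`;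
  slices of periodic `C¹` states are bounded);
* Thm. 2.1 ⇐ (2.43) ⇐ (2.25) + Lemma 2.4 ⇐ (2.28) + (2.29) + (2.42), all on bounded states:
  `Fournais2020_thm21_bdd_of_eq243_bdd`, `Fournais2020_eq243_bdd_of_lemma24_bdd`,
  `Fournais2020_lemma24_bdd_of_eq229_bdd` (`…Thm21Bdd`, `…Eq243Bdd`, `…Lemma24Bdd`; (2.25), (2.28), (2.42)
  discharged: `Fournais2020_eq225_holds`, `Fournais2020_eq228_holds`, `Fournais2020_eq242_holds`);
* (2.29) on bounded states: `Fournais2020_eq229_bdd_holds` (`PeriodicBoseGasEq229Bdd.lean`).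

Hence `Fournais2020_lowerBound_Htilde_holds`, unconditionally. (The file cannot be merged into
`PeriodicBoseGasProofs.lean` itself: the proof files above import it.)

## References

* [Fournais2020] S. Fournais, *Length scales for BEC in the dilute Bose gas*, arXiv:2011.00309,
  in: Partial Differential Equations, Spectral Theory, and Mathematical Physics (Ari Laptev
  anniversary volume), EMS Ser. Congr. Rep. 18 (2021), doi:10.4171/ecr/18-1/7: (1.11)–(1.12) p. 3–4,
  Thm. 3.1 and (3.3) p. 9, (3.14)–(3.17), Thm. 2.1, Lemmas 2.3–2.4, (2.25)–(2.29), (2.42)–(2.43).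
* [BrietzkeFournaisSolovej2020] B. Brietzke, S. Fournais, J. P. Solovej, *A simple 2nd order lower
  bound to the energy of dilute Bose gases*, Comm. Math. Phys. 376 (2020) 323–351: Thm. 6.1.
* [LSSY2005] E. H. Lieb, R. Seiringer, J. P. Solovej, J. Yngvason, *The Mathematics of the Bose Gas
  and its Condensation*, Birkhäuser 2005: App. C, Thm. C.1.
-/

noncomputable section

namespace Literature.MathematicalPhysics.QuantumManyBody.BoseGas

/-- **Fournais 2020, (1.12)** (lower bound on `H̃`, with the sign proved by (3.3)): under
Assumption 1.1, for fixed `C_L, δ > 0` there are `C, c > 0` such that on every periodic box tied to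
`ρ = N/L³` by (1.7) with `ρa³ ≤ c`, every normalised periodic `N`-body state satisfies
`⟨Ψ, H̃Ψ⟩ ≥ 4πaρN - C aρ(ρa³)^{1/2} N`. Proof: (3.3) at `ρ_μ = ρ` from Thm. 3.1, itself from the
scattering solution, the sliding localisation (3.14)–(3.17) and Thm. 2.1 on bounded states, which
rests on (2.25), Lemma 2.4 and the pairing identity (2.29) on bounded states — all proved in this
topic. [cite: Fournais2020, (1.11)–(1.12), (3.3), Thm. 3.1, Thm. 2.1] -/
theorem Fournais2020_lowerBound_Htilde_holds : Fournais2020_lowerBound_Htilde :=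
  Fournais2020_lowerBound_Htilde_of_thm31 <|
    Fournais2020_thm31_of_scattering_eq317 LSSY2005_scatteringSolution_holds <|
      Fournais2020_eq317_of_thm21_bdd <|
        Fournais2020_thm21_bdd_of_eq243_bdd <|
          Fournais2020_eq243_bdd_of_lemma24_bdd <|
            Fournais2020_lemma24_bdd_of_eq229_bdd Fournais2020_eq229_bdd_holds

end Literature.MathematicalPhysics.QuantumManyBody.BoseGas

end
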